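import Summits.Ventures.GridStability.Models.DroopQVDeflateSeq

/-!
# GridStability/Models/DroopQVDeflateSparse — the OPERATOR-SIZE lane of the G3.b RATE certificate: SPARSE Jacobian rows, a Lyapunov matrix that is positive definite BY CONSTRUCTION (`S = L̃·L̃ᵀ`), and their once-proved matrix semantics

Cell `gridfusion` (LADDER-GRIDFUSION, APEX LINE rung G3.b «droop microgrid WITH Q–V dynamics», operator-size rung; seat
gridfusion-model-8 (g3); successor item (3) of the g2 HANDOFF / `models/MODEL-8-NOTES.md` §8 sizing). The deflation lane
(`Models/DroopQVDeflation.lean`, p530169) needs, for an instance with `N = 3n` states, `S ≻ 0` and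
`H := S·(−J′) + (S·(−J′))ᵀ − 2r₀·S ≻ 0` for the deflated Jacobian `J′ = J + r·ζᵀ`. The dense evaluators `DeflRows.lyapRows`
(p536118) / `lyapRowsSeq` (p544747) cost `2N³` multiply-adds (≈ 21 kernel-min at `N = 117`) and the dense integer Gram
certificate of `S` another `≈ N³/3` (lit-5: ≈ 5.5 kernel-min at `s = 120`). Three levers, all list algebra with ONCE-PROVED semantics, every kernel pass LOCAL (a row block never needs another block's rows):
* **sparsity** — `J` of a structure-preserving (un-reduced) network has `O(n + #branches)` nonzeros per block row; it is supplied as SPARSE ROWS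
  `Jsp : List (List (ℕ × α))` (`matrixOfSparseRows`, `consDiag` for `J + c·1`), the product `T = S·(J + rζᵀ)` is accumulated row-wise by `saxpy`
  over the nonzeros with the rank-one deflation carried SYMBOLICALLY (`rowAccSparse`, `trowSparse`, `tRowsSparse`; cost `N·nnz(J)`), semantics
  **`matrixOfRows_tRowsSparse`** (`= M_S · (matrixOfSparseRows + vecMulVec r ζ)`);
* **PD by construction** — the Lyapunov matrix is DEFINED as `L̃·L̃ᵀ/d²` from an integer lower-triangular `L̃` (the emitter's rounding of a float
  Cholesky factor): `gramRowsLT n L` (ragged rows, each product stops at the shorter row, upper triangle mirrored), **`matrixOfRows_gramRowsLT`**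
  (`= M_L·M_Lᵀ`), **`posDef_mul_transpose_of_lowerTriangular`** / **`posDef_gramRowsLT_div`** (nonzero diagonal ⇒ `≻ 0`, via `det = ∏ diag`) —
  NO `N × N` PSD certificate for `S`; `triCheck` / `rowsLenLe` decide the shape on the list data;
* **integer twin of `T′ = S·(J′ + r₀·1)`** — since `H = S(−J′) + (S(−J′))ᵀ − 2r₀S = −(T′ + T′ᵀ)`, an integer literal `T̃ ≈ T′` checked ROW-BLOCK-WISE
  (`blockCheckZ`: `|T_ℤ − σ·T̃| ≤ b` and `Σ_j |S_ij| ≤ ρ` in one pass per block, `of_blockCheckZ_ranges`) plus the product perturbation bound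
  `abs_mul_sub_mul_le` (for an integer MODEL `J̃` of `J`, [cite: Rump1999VerifiedLargeSystems, §4 Algorithm 4.1 step 7]) give `|T′ − T̃| ≤ η`
  entrywise; the symmetric integer twin `twinHRows` (`−(T̃ + T̃ᵀ) − σ·1`, computed, `matrixOfRows_twinHRows`) is then read by lit-5's
  `PSD.quadForm_nonneg_of_roundedTwin_of_close` with a TRIVIAL Gram factor when it is diagonally dominant.
THREE COLUMNS. CERTIFIED (kernel): list/matrix algebra only; no instance, no parameter, no certificate. MODELLED/VALIDATED: nothing.
No sentence of this file says a grid, a microgrid or a converter is stable.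
-/

namespace Summit.Ventures.GridStability.Models

open Matrix Literature.Computation.Certificates

namespace DeflRows

section Generic
variable {α : Type*} [CommRing α]

/-! ## §1 Sparse rows -/

/-- Value at column `j` of a sparse row `[(k₁, v₁), (k₂, v₂), …]` (repeated indices add up). [folklore] -/
def sprowVal (j : ℕ) : List (ℕ × α) → α
  | [] => 0
  | (k, v) :: rest => (if k = j then v else 0) + sprowVal j rest

/-- The `m × n` matrix of a list of sparse rows (missing rows read as empty). [folklore] -/
def matrixOfSparseRows (m n : ℕ) (rows : List (List (ℕ × α))) : Matrix (Fin m) (Fin n) α :=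
  fun i j => sprowVal j.val (rows.getD i.val [])

/-- `matrixOfSparseRows` unfolds to `sprowVal`. [folklore] -/
@[simp] theorem matrixOfSparseRows_apply (m n : ℕ) (rows : List (List (ℕ × α))) (i : Fin m) (j : Fin n) :
    matrixOfSparseRows m n rows i j = sprowVal j.val (rows.getD i.val []) := rfl

/-- Add `x` at position `k` of a list (no-op past the end). [folklore] -/
def addAt : ℕ → α → List α → List α
  | _, _, [] => []
  | 0, x, a :: as => (a + x) :: as
  | k + 1, x, a :: as => a :: addAt k x as

/-- `addAt` preserves length. [folklore] -/
theorem length_addAt : ∀ (k : ℕ) (x : α) (l : List α), (addAt k x l).length = l.length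
  | _, _, [] => by simp [addAt]
  | 0, x, a :: as => by simp [addAt]
  | k + 1, x, a :: as => by simp [addAt, length_addAt k x as]

/-- Reading `addAt` inside the list. [folklore] -/
theorem getD_addAt : ∀ (k : ℕ) (x : α) (l : List α) (j : ℕ), j < l.length →
    (addAt k x l).getD j 0 = l.getD j 0 + if k = j then x else 0
  | k, x, [], j, h => by simp at h
  | 0, x, a :: as, 0, _ => by simp [addAt]
  | 0, x, a :: as, j + 1, _ => by simp [addAt]
  | k + 1, x, a :: as, 0, _ => by simp [addAt]
  | k + 1, x, a :: as, j + 1, h => by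
      simp only [addAt, List.getD_cons_succ]
      rw [getD_addAt k x as j (by simpa using h)]
      simp

/-- Sparse `acc + c·row`. [folklore] -/
def saxpy (c : α) : List (ℕ × α) → List α → List α
  | [], acc => acc
  | (k, v) :: rest, acc => saxpy c rest (addAt k (c * v) acc)

/-- `saxpy` preserves length. [folklore] -/
theorem length_saxpy (c : α) : ∀ (row : List (ℕ × α)) (acc : List α), (saxpy c row acc).length = acc.length
  | [], acc => by simp [saxpy]
  | (k, v) :: rest, acc => by rw [saxpy, length_saxpy c rest, length_addAt]

/-- Entry `j` of `saxpy c row acc` is `acc_j + c·row(j)` inside the accumulator. [folklore] -/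
theorem getD_saxpy (c : α) : ∀ (row : List (ℕ × α)) (acc : List α) (j : ℕ), j < acc.length →
    (saxpy c row acc).getD j 0 = acc.getD j 0 + c * sprowVal j row
  | [], acc, j, _ => by simp [saxpy, sprowVal]
  | (k, v) :: rest, acc, j, h => by
      rw [saxpy, getD_saxpy c rest _ j (by rw [length_addAt]; exact h), getD_addAt k _ acc j h, sprowVal]
      split_ifs <;> ring

/-- Fuel walk `acc + Σ_{t < fuel} s_t · Jsp_t` (row vector times sparse row list, lock-step `headD`/`tail`). [folklore] -/
def rowAccSparse : ℕ → List α → List (List (ℕ × α)) → List α → List α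
  | 0, _, _, acc => acc
  | f + 1, s, J, acc => rowAccSparse f s.tail J.tail (saxpy (s.headD 0) (J.headD []) acc)

/-- `rowAccSparse` preserves length. [folklore] -/
theorem length_rowAccSparse : ∀ (f : ℕ) (s : List α) (J : List (List (ℕ × α))) (acc : List α), (rowAccSparse f s J acc).length = acc.length
  | 0, _, _, _ => by simp [rowAccSparse]
  | f + 1, s, J, acc => by rw [rowAccSparse, length_rowAccSparse f, length_saxpy]

/-- `getD 0` reads the head. [folklore] -/
private theorem getD_zero_eq_headD' {β : Type*} (l : List β) (x : β) : l.getD 0 x = l.headD x := by cases l <;> rfl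

/-- `getD (k+1)` reads the tail. [folklore] -/
private theorem getD_succ_eq_getD_tail' {β : Type*} (l : List β) (k : ℕ) (x : β) :
    l.getD (k + 1) x = l.tail.getD k x := by cases l <;> simp

/-- Semantics of the fuel walk: entry `j` = `acc_j + Σ_{t : Fin f} s_t · Jsp_t(j)` (reads through `List.getD`). [folklore] -/
theorem getD_rowAccSparse : ∀ (f : ℕ) (s : List α) (J : List (List (ℕ × α))) (acc : List α) (j : ℕ), j < acc.length →
    (rowAccSparse f s J acc).getD j 0 = acc.getD j 0 + ∑ t : Fin f, s.getD t.val 0 * sprowVal j (J.getD t.val [])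
  | 0, s, J, acc, j, _ => by simp [rowAccSparse]
  | f + 1, s, J, acc, j, h => by
      rw [rowAccSparse, getD_rowAccSparse f _ _ _ j (by rw [length_saxpy]; exact h), getD_saxpy _ _ _ j h,
        Fin.sum_univ_succ]
      simp only [Fin.val_zero, Fin.val_succ, getD_zero_eq_headD', getD_succ_eq_getD_tail']
      ring

/-- Fuel dot product `Σ_{t < f} u_t v_t` (lock-step `headD`/`tail`). [folklore] -/
def dotF : ℕ → List α → List α → α
  | 0, _, _ => 0
  | f + 1, u, v => u.headD 0 * v.headD 0 + dotF f u.tail v.tail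

/-- `dotF f u v = Σ_{t : Fin f} u_t v_t`. [folklore] -/
theorem dotF_eq_sum : ∀ (f : ℕ) (u v : List α), dotF f u v = ∑ t : Fin f, u.getD t.val 0 * v.getD t.val 0
  | 0, u, v => by simp [dotF]
  | f + 1, u, v => by
      rw [dotF, Fin.sum_univ_succ, dotF_eq_sum f]
      simp only [Fin.val_zero, Fin.val_succ, getD_zero_eq_headD', getD_succ_eq_getD_tail']

/-! ## §2 Row `i` of `T = S·J′ = S·J + (S·r)·ζᵀ` and the rows of `H − δ·1` -/

/-- Row `i` of `T = S·(J + r ζᵀ)` on the `n`-window from row `i` of `S`: sparse accumulation of `S_i·J` plus `(S_i·r)·ζ`. [folklore] -/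
def trowSparse (n : ℕ) (r ζ : List α) (Jsp : List (List (ℕ × α))) (srow : List α) : List α :=
  axpy (dotF n srow r) ζ (rowAccSparse n srow Jsp (List.replicate n 0))

/-- Length of `trowSparse` is `n`. [folklore] -/
theorem length_trowSparse (n : ℕ) (r ζ : List α) (Jsp : List (List (ℕ × α))) (srow : List α) :
    (trowSparse n r ζ Jsp srow).length = n := by
  rw [trowSparse, length_axpy, length_rowAccSparse]; simp

/-- Semantics of `trowSparse`: entry `j < n` = `Σ_k S_ik J_kj + (Σ_k S_ik r_k)·ζ_j`. [folklore] -/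
theorem getD_trowSparse (n : ℕ) (r ζ : List α) (Jsp : List (List (ℕ × α))) (srow : List α) (j : Fin n) :
    (trowSparse n r ζ Jsp srow).getD j.val 0
      = (∑ k : Fin n, srow.getD k.val 0 * sprowVal j.val (Jsp.getD k.val []))
        + (∑ k : Fin n, srow.getD k.val 0 * r.getD k.val 0) * ζ.getD j.val 0 := by
  rw [trowSparse, getD_axpy _ _ _ _ (by rw [length_rowAccSparse]; simp), getD_rowAccSparse _ _ _ _ _ (by simp), dotF_eq_sum]
  simp

/-- All rows of `T = S·J′` on the window. [folklore] -/
def tRowsSparse (n : ℕ) (r ζ : List α) (Jsp : List (List (ℕ × α))) (S : List (List α)) : List (List α) :=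
  (List.finRange n).map fun i : Fin n => trowSparse n r ζ Jsp (S.getD i.val [])

/-! ## §3 `S := L̃·L̃ᵀ` from ragged lower-triangular rows; positive definite by construction -/

/-- Dot product of two lists, stopping at the SHORTER one (ragged rows of a triangular factor). [folklore] -/
def ldotT : List α → List α → α
  | a :: as, b :: bs => a * b + ldotT as bs
  | _, _ => 0

/-- `ldotT u v` is the `Fin N` sum through `List.getD` as soon as `N` covers the shorter list. [folklore] -/
theorem ldotT_eq_sum : ∀ (u v : List α) (N : ℕ), min u.length v.length ≤ N →
    ldotT u v = ∑ k : Fin N, u.getD k.val 0 * v.getD k.val 0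
  | [], v, N, _ => by simp [ldotT]
  | a :: as, [], N, _ => by simp [ldotT]
  | a :: as, b :: bs, 0, h => by simp at h
  | a :: as, b :: bs, N + 1, h => by
      rw [ldotT, ldotT_eq_sum as bs N (by simp only [List.length_cons] at h; omega), Fin.sum_univ_succ]
      simp

/-- Lower triangle of `L̃·L̃ᵀ`: row `i` = `[⟨L_i, L_0⟩, …, ⟨L_i, L_i⟩]` (`i + 1` ragged dots). [folklore] -/
def gramLowRows (n : ℕ) (L : List (List α)) : List (List α) :=
  (List.finRange n).map fun i : Fin n => (List.finRange (i.val + 1)).map fun j : Fin (i.val + 1) =>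
    ldotT (L.getD i.val []) (L.getD j.val [])

/-- **Rows of `S := L̃·L̃ᵀ`** on the `n`-window, the upper triangle MIRRORED from the lower one (so `≈ N³/6` multiplications when the rows of
`L̃` are ragged lower-triangular). [folklore] -/
def gramRowsLT (n : ℕ) (L : List (List α)) : List (List α) :=
  (List.finRange n).map fun i : Fin n => (List.finRange n).map fun j : Fin n =>
    if j.val ≤ i.val then ((gramLowRows n L).getD i.val []).getD j.val 0 else ((gramLowRows n L).getD j.val []).getD i.val 0

/-- Bool check: every row `i < n` of `L` has length `≤ n` (so ragged dots are `Fin n` sums). [folklore] -/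
def rowsLenLe (n : ℕ) (L : List (List α)) : Bool :=
  (List.finRange n).all fun i : Fin n => decide ((L.getD i.val []).length ≤ n)

/-- Reading the lower table. [folklore] -/
theorem getD_gramLowRows (n : ℕ) (L : List (List α)) (i j : Fin n) (hji : j.val ≤ i.val) (hlen : rowsLenLe n L = true) :
    ((gramLowRows n L).getD i.val []).getD j.val 0 = ∑ k : Fin n, (L.getD i.val []).getD k.val 0 * (L.getD j.val []).getD k.val 0 := by
  rw [gramLowRows, getD_map_finRange]
  have hj : j.val < i.val + 1 := by omega
  have h := getD_map_finRange (fun j' : Fin (i.val + 1) => ldotT (L.getD i.val []) (L.getD j'.val [])) 0 ⟨j.val, hj⟩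
  simp only at h
  rw [h]
  have hl : ∀ a : Fin n, (L.getD a.val []).length ≤ n := by
    intro a
    have := List.all_eq_true.1 hlen a (List.mem_finRange a)
    simpa using this
  exact ldotT_eq_sum _ _ n (le_trans (min_le_left _ _) (hl i))

/-- **Matrix semantics of `gramRowsLT`**: `matrixOfRows n n (gramRowsLT n L) = M_L · M_Lᵀ` (`M_L = matrixOfRows n n L`). [folklore] -/
theorem matrixOfRows_gramRowsLT (n : ℕ) (L : List (List α)) (hlen : rowsLenLe n L = true) :
    matrixOfRows n n (gramRowsLT n L) = matrixOfRows n n L * (matrixOfRows n n L)ᵀ := by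
  ext i j
  rw [matrixOfRows_apply, gramRowsLT, getD_map_finRange, getD_map_finRange]
  simp only [Matrix.mul_apply, Matrix.transpose_apply, matrixOfRows_apply]
  split_ifs with hji
  · exact getD_gramLowRows n L i j hji hlen
  · rw [getD_gramLowRows n L j i (by omega) hlen]
    exact Finset.sum_congr rfl fun k _ => mul_comm _ _

/-- Bool check: ragged LOWER-TRIANGULAR rows (row `i` has length `≤ i + 1`) with NONZERO diagonal. [folklore] -/
def triCheck [DecidableEq α] (n : ℕ) (L : List (List α)) : Bool :=
  (List.finRange n).all fun i : Fin n => decide ((L.getD i.val []).length ≤ i.val + 1) && !decide ((L.getD i.val []).getD i.val 0 = 0)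

/-- `triCheck` semantics: strictly-upper entries vanish, diagonal entries are nonzero. [folklore] -/
theorem triCheck_spec [DecidableEq α] {n : ℕ} {L : List (List α)} (h : triCheck n L = true) :
    (∀ i j : Fin n, i < j → matrixOfRows n n L i j = 0) ∧ (∀ i : Fin n, matrixOfRows n n L i i ≠ 0) := by
  have hrow : ∀ i : Fin n, (L.getD i.val []).length ≤ i.val + 1 ∧ (L.getD i.val []).getD i.val 0 ≠ 0 := by
    intro i
    have := List.all_eq_true.1 h i (List.mem_finRange i)
    simpa using this
  refine ⟨fun i j hij => ?_, fun i => ?_⟩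
  · rw [matrixOfRows_apply, List.getD_eq_getElem?_getD, List.getElem?_eq_none_iff.2 (by have := (hrow i).1; omega)]
    rfl
  · rw [matrixOfRows_apply]; exact (hrow i).2

/-- **A lower-triangular real matrix with nonzero diagonal gives `L·Lᵀ ≻ 0`.** [folklore] -/
theorem posDef_mul_transpose_of_lowerTriangular {n : ℕ} (L : Matrix (Fin n) (Fin n) ℝ)
    (htri : ∀ i j : Fin n, i < j → L i j = 0) (hdiag : ∀ i, L i i ≠ 0) : (L * Lᵀ).PosDef := by
  have hBT : L.BlockTriangular OrderDual.toDual := fun i j hij => htri i j (by simpa using hij)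
  have hdet : L.det ≠ 0 := by
    rw [Matrix.det_of_lowerTriangular L hBT]
    exact Finset.prod_ne_zero_iff.2 fun i _ => hdiag i
  have hU : IsUnit L := (Matrix.isUnit_iff_isUnit_det L).2 (isUnit_iff_ne_zero.2 hdet)
  have h := Matrix.PosDef.mul_mul_conjTranspose_same Matrix.PosDef.one (Matrix.vecMul_injective_iff_isUnit.2 hU)
  simpa [Matrix.conjTranspose_eq_transpose_of_trivial] using h

/-- **`S := (L̃/d)·(L̃/d)ᵀ ≻ 0` from the list data**, any nonzero rational scale `d` (the emitter divides the integer Gram rows by `d²`). [folklore] -/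
theorem posDef_gramRowsLT_div {n : ℕ} {L : List (List ℤ)} (htri : triCheck n L = true) (hlen : rowsLenLe n L = true) (d : ℚ) (hd : d ≠ 0) :
    (((matrixOfRows n n (gramRowsLT n L)).map (fun z : ℤ => (z : ℚ) / d ^ 2)).map ((↑) : ℚ → ℝ)).PosDef := by
  obtain ⟨h1, h2⟩ := triCheck_spec htri
  rw [matrixOfRows_gramRowsLT n L hlen]
  have hmap : (((matrixOfRows n n L * (matrixOfRows n n L)ᵀ).map (fun z : ℤ => (z : ℚ) / d ^ 2)).map ((↑) : ℚ → ℝ))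
      = ((matrixOfRows n n L).map (fun z : ℤ => ((z : ℚ) / d : ℝ))) * ((matrixOfRows n n L).map (fun z : ℤ => ((z : ℚ) / d : ℝ)))ᵀ := by
    ext i j
    simp only [Matrix.map_apply, Matrix.mul_apply, Matrix.transpose_apply, Int.cast_sum, Int.cast_mul, Rat.cast_sum,
      Rat.cast_div, Rat.cast_mul, Rat.cast_intCast, Rat.cast_pow, Finset.sum_div]
    exact Finset.sum_congr rfl fun k _ => by ring
  rw [hmap]
  refine posDef_mul_transpose_of_lowerTriangular _ (fun i j hij => ?_) (fun i => ?_)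
  · rw [Matrix.map_apply, h1 i j hij]; simp
  · have hd' : ((d : ℚ) : ℝ) ≠ 0 := by exact_mod_cast hd
    have h2i : ((matrixOfRows n n L i i : ℤ) : ℝ) ≠ 0 := by exact_mod_cast h2 i
    simp only [Matrix.map_apply]
    push_cast
    exact div_ne_zero h2i hd'

/-! ## §4 The symmetric integer twin of `H − δ·1`, the matrix semantics of `tRowsSparse`, and `consDiag` -/

/-- **The symmetric integer twin of `H − δ·1`** from an integer twin `T̃` of `T′ = S(J′ + r₀·1)`: row `i`, entry `j` =
`−(T̃_ij + T̃_ji) − σ[i=j]` (computed by the kernel from the literal `T̃`; `σ = δ + s` for the `s`-shifted twin). [folklore] -/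
def twinHRows (n : ℕ) (σ : ℤ) (Tt : List (List ℤ)) : List (List ℤ) :=
  (List.finRange n).map fun i : Fin n => (List.finRange n).map fun j : Fin n =>
    -((Tt.getD i.val []).getD j.val 0 + (Tt.getD j.val []).getD i.val 0) - (if i = j then σ else 0)

/-- Semantics of `twinHRows`. [folklore] -/
theorem matrixOfRows_twinHRows (n : ℕ) (σ : ℤ) (Tt : List (List ℤ)) (i j : Fin n) :
    matrixOfRows n n (twinHRows n σ Tt) i j = -(matrixOfRows n n Tt i j + matrixOfRows n n Tt j i) - (if i = j then σ else 0) := by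
  rw [matrixOfRows_apply, twinHRows, getD_map_finRange, getD_map_finRange]
  simp [matrixOfRows_apply]

/-- Semantics of `tRowsSparse` as a matrix: `matrixOfRows n n (tRowsSparse n r ζ Jsp S) = M_S · (matrixOfSparseRows n n Jsp + vecMulVec r ζ)`.
[folklore] -/
theorem matrixOfRows_tRowsSparse (n : ℕ) (r ζ : List α) (Jsp : List (List (ℕ × α))) (S : List (List α)) :
    matrixOfRows n n (tRowsSparse n r ζ Jsp S)
      = matrixOfRows n n S * (matrixOfSparseRows n n Jsp + vecMulVec (vecOfList n r) (vecOfList n ζ)) := by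
  ext i j
  rw [matrixOfRows_apply, tRowsSparse, getD_map_finRange, getD_trowSparse]
  simp only [Matrix.mul_apply, Matrix.add_apply, matrixOfRows_apply, matrixOfSparseRows_apply, Matrix.vecMulVec_apply,
    vecOfList_apply, mul_add, Finset.sum_add_distrib, Finset.sum_mul, mul_assoc]

/-- Prepend the diagonal pair `(i, c)` to every sparse row: the table of `M + c·1`. [folklore] -/
def consDiag (n : ℕ) (c : α) (Jsp : List (List (ℕ × α))) : List (List (ℕ × α)) :=
  (List.finRange n).map fun i : Fin n => (i.val, c) :: Jsp.getD i.val []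

/-- Semantics of `consDiag`: `matrixOfSparseRows n n (consDiag n c Jsp) = matrixOfSparseRows n n Jsp + c·1`. [folklore] -/
theorem matrixOfSparseRows_consDiag (n : ℕ) (c : α) (Jsp : List (List (ℕ × α))) :
    matrixOfSparseRows n n (consDiag n c Jsp) = matrixOfSparseRows n n Jsp + c • (1 : Matrix (Fin n) (Fin n) α) := by
  ext i j
  rw [matrixOfSparseRows_apply, consDiag, getD_map_finRange, sprowVal]
  simp only [Matrix.add_apply, matrixOfSparseRows_apply, Matrix.smul_apply, Matrix.one_apply, smul_eq_mul, mul_ite, mul_one,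
    mul_zero, Fin.val_eq_val]
  split_ifs <;> ring

/-! ## §5 INTEGER lane for `T′`: row-range closeness `|A_ij − σ·B_ij| ≤ b` and row absolute sums over `ℤ`; the product perturbation bound -/

/-- One row over `ℤ`: `|a_j − σ·b_j| ≤ b` for the first `f` entries. [folklore] -/
def rowCloseZ (b : ℕ) (σ : ℤ) : ℕ → List ℤ → List ℤ → Bool
  | 0, _, _ => true
  | f + 1, a, m => decide ((a.headD 0 - σ * m.headD 0).natAbs ≤ b) && rowCloseZ b σ f a.tail m.tail

/-- Semantics of `rowCloseZ`. [folklore] -/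
theorem abs_sub_le_of_rowCloseZ (b : ℕ) (σ : ℤ) : ∀ (f : ℕ) (a m : List ℤ), rowCloseZ b σ f a m = true →
    ∀ j : ℕ, j < f → |a.getD j 0 - σ * m.getD j 0| ≤ (b : ℤ)
  | 0, a, m, _, j, hj => by omega
  | f + 1, a, m, h, 0, _ => by
      rw [rowCloseZ, Bool.and_eq_true, decide_eq_true_eq] at h
      rw [getD_zero_eq_headD', getD_zero_eq_headD', Int.abs_eq_natAbs]
      exact_mod_cast h.1
  | f + 1, a, m, h, j + 1, hj => by
      rw [rowCloseZ, Bool.and_eq_true] at h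
      rw [getD_succ_eq_getD_tail', getD_succ_eq_getD_tail']
      exact abs_sub_le_of_rowCloseZ b σ f a.tail m.tail h.2 j (by omega)

/-- Row absolute sum over `ℤ` for the first `f` entries. [folklore] -/
def rowAbsZ : ℕ → List ℤ → ℕ
  | 0, _ => 0
  | f + 1, a => (a.headD 0).natAbs + rowAbsZ f a.tail

/-- Semantics of `rowAbsZ`. [folklore] -/
theorem rowAbsZ_eq_sum : ∀ (f : ℕ) (a : List ℤ), ((rowAbsZ f a : ℕ) : ℤ) = ∑ j : Fin f, |a.getD j.val 0|
  | 0, a => by simp [rowAbsZ]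
  | f + 1, a => by
      rw [rowAbsZ, Fin.sum_univ_succ, Nat.cast_add, rowAbsZ_eq_sum f a.tail]
      simp only [Fin.val_zero, Fin.val_succ, getD_zero_eq_headD', getD_succ_eq_getD_tail', Int.natCast_natAbs]

/-- **Row-RANGE block check over `ℤ`** (rows `lo ≤ i < lo + k` of the `n`-window): closeness `|A_ij − σ·B_ij| ≤ b` AND row absolute sums
`Σ_j |C_ij| ≤ ρ` — both in ONE kernel pass so that a computed `A` (e.g. `tRowsSparse` over `C = gramRowsLT …`) shares the rows of `C`. [folklore] -/
def blockCheckZ (n : ℕ) (b : ℕ) (σ : ℤ) (ρ : ℕ) (lo k : ℕ) (A B C : List (List ℤ)) : Bool :=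
  (List.finRange k).all fun t : Fin k =>
    rowCloseZ b σ n (A.getD (lo + t.val) []) (B.getD (lo + t.val) []) && decide (rowAbsZ n (C.getD (lo + t.val) []) ≤ ρ)

/-- Semantics of `blockCheckZ` on its range: closeness. [folklore] -/
theorem abs_sub_le_of_blockCheckZ {n b : ℕ} {σ : ℤ} {ρ lo k : ℕ} {A B C : List (List ℤ)}
    (h : blockCheckZ n b σ ρ lo k A B C = true) (i j : Fin n) (hlo : lo ≤ i.val) (hhi : i.val < lo + k) :
    |matrixOfRows n n A i j - σ * matrixOfRows n n B i j| ≤ (b : ℤ) := by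
  unfold blockCheckZ at h
  rw [List.all_eq_true] at h
  have ht := h ⟨i.val - lo, by omega⟩ (List.mem_finRange _)
  have hi : lo + (i.val - lo) = i.val := by omega
  rw [Bool.and_eq_true] at ht
  simp only [hi] at ht
  simpa [matrixOfRows_apply] using abs_sub_le_of_rowCloseZ b σ n _ _ ht.1 j.val j.isLt

/-- Semantics of `blockCheckZ` on its range: row absolute sums. [folklore] -/
theorem sum_abs_le_of_blockCheckZ {n b : ℕ} {σ : ℤ} {ρ lo k : ℕ} {A B C : List (List ℤ)}
    (h : blockCheckZ n b σ ρ lo k A B C = true) (i : Fin n) (hlo : lo ≤ i.val) (hhi : i.val < lo + k) :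
    ∑ j : Fin n, |matrixOfRows n n C i j| ≤ (ρ : ℤ) := by
  unfold blockCheckZ at h
  rw [List.all_eq_true] at h
  have ht := h ⟨i.val - lo, by omega⟩ (List.mem_finRange _)
  have hi : lo + (i.val - lo) = i.val := by omega
  rw [Bool.and_eq_true, decide_eq_true_eq] at ht
  simp only [hi] at ht
  have h2 : ((rowAbsZ n (C.getD i.val []) : ℕ) : ℤ) ≤ (ρ : ℤ) := by exact_mod_cast ht.2
  rw [rowAbsZ_eq_sum] at h2
  simpa [matrixOfRows_apply] using h2

/-- Both facts on ALL rows from `mch` blocks of width `k` covering the window. [folklore] -/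
theorem of_blockCheckZ_ranges {n mch k b : ℕ} {σ : ℤ} {ρ : ℕ} {A B C : List (List ℤ)}
    (h : ∀ c : Fin mch, blockCheckZ n b σ ρ (c.val * k) k A B C = true) (hcover : n ≤ mch * k) (i : Fin n) :
    (∀ j : Fin n, |matrixOfRows n n A i j - σ * matrixOfRows n n B i j| ≤ (b : ℤ)) ∧ ∑ j : Fin n, |matrixOfRows n n C i j| ≤ (ρ : ℤ) := by
  have hk : 0 < k := by
    rcases Nat.eq_zero_or_pos k with hk | hk
    · subst hk; have := i.isLt; omega
    · exact hk
  have hc : i.val / k < mch := by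
    by_contra hnot
    rw [not_lt] at hnot
    have h1 : mch * k ≤ (i.val / k) * k := Nat.mul_le_mul_right k hnot
    have h2 : (i.val / k) * k ≤ i.val := Nat.div_mul_le_self i.val k
    have := i.isLt; omega
  have hlo : i.val / k * k ≤ i.val := Nat.div_mul_le_self i.val k
  have hhi : i.val < i.val / k * k + k := by
    have := Nat.lt_div_mul_add hk (a := i.val)
    simpa [Nat.mul_comm] using this
  exact ⟨fun j => abs_sub_le_of_blockCheckZ (h ⟨i.val / k, hc⟩) i j hlo hhi, sum_abs_le_of_blockCheckZ (h ⟨i.val / k, hc⟩) i hlo hhi⟩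

/-- **Product perturbation**: `|(S·A)_ij − (S·B)_ij| ≤ ρ·η` when `Σ_k |S_ik| ≤ ρ` and `|A − B| ≤ η` entrywise (`η ≥ 0`). [folklore] -/
theorem abs_mul_sub_mul_le {n : ℕ} {S A B : Matrix (Fin n) (Fin n) ℚ} {ρ η : ℚ}
    (hS : ∀ i, ∑ k, |S i k| ≤ ρ) (hAB : ∀ i j, |A i j - B i j| ≤ η) (hη : 0 ≤ η) (i j : Fin n) :
    |(S * A) i j - (S * B) i j| ≤ ρ * η := by
  have hsub : (S * A) i j - (S * B) i j = ∑ k, S i k * (A k j - B k j) := by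
    simp only [Matrix.mul_apply, ← Finset.sum_sub_distrib, mul_sub]
  rw [hsub]
  calc |∑ k, S i k * (A k j - B k j)| ≤ ∑ k, |S i k * (A k j - B k j)| := Finset.abs_sum_le_sum_abs _ _
    _ = ∑ k, |S i k| * |A k j - B k j| := Finset.sum_congr rfl fun k _ => abs_mul _ _
    _ ≤ ∑ k, |S i k| * η := Finset.sum_le_sum fun k _ => mul_le_mul_of_nonneg_left (hAB k j) (abs_nonneg _)
    _ = (∑ k, |S i k|) * η := (Finset.sum_mul _ _ _).symm
    _ ≤ ρ * η := mul_le_mul_of_nonneg_right (hS i) hη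

end Generic

end DeflRows

end Summit.Ventures.GridStability.Models
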